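import Summits.BirchSwinnertonDyer.BirchSwinnertonDyer.Theorems.SignedLowerHalvesKobayashiLowerHalfLargeImageShadowSerreLevel
import Literature.NumberTheory.EllipticCurves.SkinnerUrban2014.SemistableCurvesProofs
import Literature.NumberTheory.EllipticCurves.NonEisensteinPrimeOfSurjective
import Literature.NumberTheory.Automorphic.SerreWeakImpliesStrong
import HarnessLib

/-!
# Route `SignedLowerHalves` (K3), crux 3 `KobayashiLowerHalfLargeImage` (item stmt-BirchSwinnertonDyer-19001), line `shadow_seed`:
# THE SHADOW LEVEL-LOWERING DOOR — a weight-two newform `g` of level `M ∣ N(ρ̄_{E,3})` with `q ∥ M` at a shadow prime `q`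
# (cell `bsd-ssimc`, width seat `bsd-line-slh-p1-w5` g2; `--supports stmt-BirchSwinnertonDyer-19001`)

WHAT. The first published link of line `shadow_seed`'s composite binder `ShadowSeedTransport_OPEN` (Diamond 1995 Thm 1.1 + the
local lemma «shadow ⇒ `q ∥ N(ρ̄)`»): for `E/ℚ` with good reduction at `3` and `E[3]` irreducible (e.g. `Surj W 3`), and a prime
`q ∉ {2, 3}` of ADDITIVE reduction with `3 ∣ c_q` (a shadow prime `q ≥ 5`: Kodaira `IV`/`IV*`, `c_q = 3`), granted the Modularity
Theorem (`exists_isNewformOf`) and Diamond's refined level lowering (`diamond1995_refinedSerre`, Ribet 1990 + Diamond 1995, `ℓ = 3`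
allowed) BY NAME: **there is a newform `g ∈ S₂(Γ₁(M))` with `ρ̄_g ≅ E[3] ⊗ 𝔽̄₃`, `M ∣ N(ρ̄)`, `3 ∤ M` and `q ∥ M`**
(`exists_newform_two_of_dvd_localTamagawaNumber`; the crux-binder reading `…_of_surj_of_kodairaSymbol_IV_or_IVstar`).

HOW (template: the tree's `SkinnerUrban2014.ram_of_semistable_of_irr`). `ρ̄' = ρ̄ ⊗ 𝔽̄₃` is absolutely irreducible
(`isAbsolutelyIrreducible_of_hasIrreducibleModPGaloisRep`, `p = 3 ≠ 2`), odd (`det = χ̄₃`), modular (`E` is), of Serre weight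
`k(ρ̄') = 2` at the place over `3` (good reduction, `serreWeight_eq_two_of_hasGoodReductionAt`, `p = 3` allowed); Diamond's theorem
gives `g` of weight `2` and level `M ∣ N(ρ̄')`; `3 ∤ N(ρ̄')` (`not_dvd_serreLevel`); `ord_q N(ρ̄') = 1`
(`ShadowSeedSerreLevel.factorization_serreLevel_baseChange_three_eq_one_of_dvd_localTamagawaNumber`, this seat's file 2: `E[3]^{I_q}` is
exactly a line, Swan `= 0`), so `ord_q M ≤ 1`; and `q ∣ M`, for otherwise `ρ̄'` would be unramified at `q` (`IsGaloisRepOfNewform1Int`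
off `M·3`), forcing `a_q(ρ̄') = 0` (`artinConductorExponent_eq_zero_of_isUnramifiedAt_holds`) against `a_q(ρ̄') = ord_q N(ρ̄') = 1`.

NOT DONE HERE (said): the descent `Γ₁(M) → Γ₀(M)` (trivial character: Carayol's lemma at `ℓ = 3` needs `ρ̄|G_{ℚ(√−3)}`
absolutely irreducible ⟸ `Surj W 3`; not in the tree at `ℓ = 3`), the local type of `g` at `q` (Steinberg ⊗ unramified
quadratic `μ`), the forms-level FW21 Thm 5.1 (PRE) and Fouquet 2025 Thm 4.1 — the remaining links of `ShadowSeedTransport_OPEN`.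
HONEST FRAMING: conditional on two PUBLISHED named facts (Modularity, Diamond 1995) exactly as the tree's semistable level-lowering
theorems; no `sorry`, no new definition, no new named fact; the crux, the line's stubs and BSD are NOT proved; no summit statement touched.
[cite: Diamond1995RefinedSerre, Thm. 1.1] [cite: Ribet1990, Thm. 1.1] [cite: Serre1987, §1.2, §2.8, §4.6] [cite: Kraus1997, p. 1143]
[cite: BreuilConradDiamondTaylor2001, Thm. A]
-/

set_option autoImplicit false
set_option linter.dupNamespace false

noncomputable section

open scoped Classical MatrixGroups ModularForm NumberField

open WeierstrassCurve Literature.NumberTheory Literature.NumberTheory.GaloisRepresentations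
  Literature.NumberTheory.EllipticCurves Literature.NumberTheory.EllipticCurves.ModularForms
  Rat.HeightOneSpectrum IsDedekindDomain IsDedekindDomain.HeightOneSpectrum
  Literature.NumberTheory.Automorphic Literature.NumberTheory.Automorphic.BCDT
  Literature.NumberTheory.DiophantineGeometry Literature.NumberTheory.EllipticCurves.Rank1Residual
  Literature.NumberTheory.GaloisRepresentations.ModPGaloisRep
  Literature.NumberTheory.GaloisRepresentations.IsNonarchimedeanLocalField
  ValuativeRel CongruenceSubgroup Literature.NumberTheory.EllipticCurves.SkinnerUrban2014
  Summit.BirchSwinnertonDyer.BirchSwinnertonDyer.Theorems.NonSurjCornerSerreLevelExact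
  Summit.BirchSwinnertonDyer.BirchSwinnertonDyer.Theorems.ShadowSeedSerreLevel

namespace Summit.BirchSwinnertonDyer.BirchSwinnertonDyer.Theorems.ShadowSeedLevelLowering

/-- **THE SHADOW LEVEL-LOWERING DOOR.** `E/ℚ` elliptic, good at `3`, `E[3]` irreducible; `q ∉ {2, 3}` a prime of ADDITIVE reduction
with `3 ∣ c_q` (`ℤ_[q]`-currency). Granted Modularity (`hmod`) and Diamond 1995 Thm 1.1 (`hLL`) BY NAME: for the framed model `ρ̄` of
`E[3]` and `ρ̄' = ρ̄ ⊗ 𝔽̄₃` there are a level `M` with `M ∣ N(ρ̄')`, `3 ∤ M`, **`ord_q M = 1 = ord_q N(ρ̄')`**, and a newform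
`g ∈ S₂(Γ₁(M))` with `ρ̄_g ≅ ρ̄'` (`IsGaloisRepOfNewform1Int g ι {r ∣ M·3} ρ̄'`). Proof in the module docstring.
[cite: Diamond1995RefinedSerre, Thm. 1.1] [cite: Ribet1990, Thm. 1.1] [cite: Serre1987, §1.2, §2.8 Prop. 3–4, §4.6 (4.6.3)] -/
theorem exists_newform_two_of_dvd_localTamagawaNumber (hmod : exists_isNewformOf) (hLL : diamond1995_refinedSerre)
    [TopologicalSpace (AlgebraicClosure (ZMod 3))] [DiscreteTopology (AlgebraicClosure (ZMod 3))]
    (W : WeierstrassCurve ℚ) [W.IsElliptic] (hgood : W.HasGoodReductionAtPrime 3) (hirr : Irr W 3)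
    (q : ℕ) [Fact q.Prime] (hq2 : q ≠ 2) (hq3 : q ≠ 3)
    (hng : ¬ W.HasGoodReductionAtPrime q) (hnm : ¬ W.HasMultiplicativeReductionAtPrime q)
    (hdvd : 3 ∣ (W.baseChange ℚ_[q]).localTamagawaNumber ℤ_[q])
    {ρ : ModPGaloisRep ℚ (ZMod 3) 2} (hρ : W.IsTorsionGaloisRep 3 ρ) :
    ∃ (M : ℕ) (_ : NeZero M),
      M ∣ serreLevel 3 (FramedRep.baseChange (algebraMap (ZMod 3) (AlgebraicClosure (ZMod 3)))
            continuous_of_discreteTopology ρ) ∧ ¬ 3 ∣ M ∧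
      (serreLevel 3 (FramedRep.baseChange (algebraMap (ZMod 3) (AlgebraicClosure (ZMod 3)))
            continuous_of_discreteTopology ρ)).factorization q = 1 ∧
      M.factorization q = 1 ∧
      ∃ (g : CuspForm (Gamma1 M) 2) (ιg : coeffCharIntegers g →+* AlgebraicClosure (ZMod 3)),
        IsNewform1 g ∧ IsGaloisRepOfNewform1Int g ιg {r | r ∣ M * 3}
          (FramedRep.baseChange (algebraMap (ZMod 3) (AlgebraicClosure (ZMod 3)))
            continuous_of_discreteTopology ρ) := by
  classical
  have hp : (3 : ℕ).Prime := Nat.prime_three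
  have hp2 : (3 : ℕ) ≠ 2 := by decide
  have hodd : Odd 3 := by decide
  haveI : ContinuousAdd (AlgebraicClosure (ZMod 3)) := ⟨continuous_of_discreteTopology⟩
  haveI : ContinuousMul (AlgebraicClosure (ZMod 3)) := ⟨continuous_of_discreteTopology⟩
  haveI : ContinuousNeg (AlgebraicClosure (ZMod 3)) := ⟨continuous_of_discreteTopology⟩
  haveI : IsTopologicalSemiring (AlgebraicClosure (ZMod 3)) := ⟨⟩
  haveI : IsTopologicalRing (AlgebraicClosure (ZMod 3)) := ⟨⟩
  /- Step 1. `ρ̄' = ρ̄ ⊗ 𝔽̄₃`: irreducible and odd. -/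
  haveI : NeZero (((3 : ℕ) : ℕ) : ℚ) := ⟨by norm_num⟩
  set j : ZMod 3 →+* AlgebraicClosure (ZMod 3) := algebraMap (ZMod 3) (AlgebraicClosure (ZMod 3)) with hj
  set ρ' : ModPGaloisRep ℚ (AlgebraicClosure (ZMod 3)) 2 :=
    FramedRep.baseChange j continuous_of_discreteTopology ρ with hρ'
  have habs := isAbsolutelyIrreducible_of_hasIrreducibleModPGaloisRep W hp2 hirr hρ
  have hirr' : ρ'.toGaloisRep.IsIrreducible := by
    rw [← ModPGaloisRep.isIrreducible_iff_toGaloisRep]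
    exact habs.isIrreducible_baseChange (AlgebraicClosure (ZMod 3)) j _
  have hodd' : FramedGaloisRep.IsOdd ρ' :=
    (ModPGaloisRep.isOdd_of_det_eq_modPCyclotomicCharacterZMod ρ
      (W.det_eq_modPCyclotomicCharacter_of_isTorsionGaloisRep_holds 3 ρ hρ)).baseChange j _
  /- Step 2. `ρ̄'` is modular, `E` being modular (`hmod`). -/
  haveI : NeZero (W.conductorNorm ℤ) := ⟨(conductorNorm_pos_holds W).ne'⟩
  have hWmod : BCDT.IsModular W := exists_isNewformOf_iff.mp hmod W
  have hρmod : ModPGaloisRep.IsModular ρ := hWmod.isModular_of_isTorsionGaloisRep'' hρ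
  have hρ'mod : ModPGaloisRep.IsModular ρ' := hρmod.baseChange_algebraicClosure
  /- Step 3. The canonical local datum at the place `v` above `3`; the weight is `2` (good reduction at `3`). -/
  obtain ⟨v, hv⟩ : ∃ v : HeightOneSpectrum (𝓞 ℚ), primesEquiv v = ⟨3, hp⟩ :=
    ⟨(primesEquiv (R := 𝓞 ℚ)).symm ⟨3, hp⟩, Equiv.apply_symm_apply _ _⟩
  have hpv' : ((3 : ℕ) : 𝓞 ℚ) ∈ v.asIdeal := (natCast_mem_asIdeal_iff_primesEquiv_eq v hp).mpr (by rw [hv])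
  have hgoodv : W.HasGoodReductionAt v := by
    have h := WeierstrassCurve.hasGoodReductionAtPrime_iff_hasGoodReductionAt_ringOfIntegers (v := v) W
    rw [hv] at h
    exact h.mp hgood
  set loc : LocalRestrictionAt 3 ρ' :=
    { F := v.adicCompletion ℚ
      residueFieldCard_eq := residueFieldCard_adicCompletion_eq_of_natCast_mem hpv'
      irreducible_natCast := irreducible_natCast_valuativeInteger_adicCompletion_of_natCast_mem hpv'
      rep := FramedGaloisRep.restrictField (v.adicCompletion ℚ) ρ'
      rep_eq_restrictField := rfl } with hloc
  obtain ⟨ι⟩ := nonempty_ringHom_residue (k := AlgebraicClosure (ZMod 3)) 3 (v.adicCompletion ℚ)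
    (residueFieldCard_adicCompletion_eq_of_natCast_mem hpv')
  have hw : (serreWeight 3 ρ' loc ι : ℤ) = 2 := by
    have h2 : serreWeight 3 ρ' loc ι = 2 :=
      serreWeight_eq_two_of_hasGoodReductionAt W 3 hp2 v hpv' hgoodv hρ (AlgebraicClosure (ZMod 3)) j ι
    rw [h2]; rfl
  /- Step 4. Level-lowering: `ρ̄'` arises from a newform `g` of weight `2` and level `M ∣ N(ρ̄')`. -/
  obtain ⟨M, hMz, hMN, g, ιg, hg, hgal⟩ := hLL 3 hodd (AlgebraicClosure (ZMod 3)) ρ' hirr' hodd' hρ'mod loc ι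
  revert hgal hg ιg g
  rw [hw]
  intro g ιg hg hgal
  haveI : NeZero M := hMz
  /- Step 5. `ord_q N(ρ̄') = 1` (file 2), `3 ∤ M`, and `q ∣ M` (else `ρ̄'` unramified at `q`). -/
  have hq : q.Prime := Fact.out
  have hN1 : (serreLevel 3 ρ').factorization q = 1 :=
    factorization_serreLevel_baseChange_three_eq_one_of_dvd_localTamagawaNumber W hρ j _ q hq2 hq3 hng hnm hdvd
  have hN0 : serreLevel 3 ρ' ≠ 0 := fun h0 ↦ not_dvd_serreLevel 3 ρ' (h0 ▸ dvd_zero 3)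
  have hM0 : M ≠ 0 := hMz.out
  have h3M : ¬ 3 ∣ M := fun h ↦ not_dvd_serreLevel 3 ρ' (h.trans hMN)
  have hqM : q ∣ M := by
    by_contra hqM
    -- `q ∉ {r | r ∣ M * 3}`, so `ρ̄'` is unramified at the place over `q`
    set u : HeightOneSpectrum (𝓞 ℚ) := (primesEquiv (R := 𝓞 ℚ)).symm ⟨q, hq⟩ with hudef
    have hu : (primesEquiv u : Nat.Primes) = ⟨q, hq⟩ := Equiv.apply_symm_apply _ _
    have huq : ((primesEquiv u : Nat.Primes) : ℕ) = q := by rw [hu]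
    have huS : ((primesEquiv u : Nat.Primes) : ℕ) ∉ {r | r ∣ M * 3} := by
      rw [huq]
      intro h'
      rcases (Nat.Prime.dvd_mul hq).mp h' with h1 | h1
      · exact hqM h1
      · exact hq3 ((Nat.prime_dvd_prime_iff_eq hq hp).mp h1)
    have hunr : ρ'.toGaloisRep.IsUnramifiedAt u :=
      (FramedGaloisRep.isUnramifiedAt_toGaloisRep_iff u ρ').mpr (hgal u huS).1
    have h0 : (FramedGaloisRep.toGaloisRep ρ').artinConductorExponent u = 0 :=
      GaloisRep.artinConductorExponent_eq_zero_of_isUnramifiedAt_holds hunr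
    have h1 : (serreLevel 3 ρ').factorization q = (FramedGaloisRep.toGaloisRep ρ').artinConductorExponent u := by
      rw [← huq]
      exact factorization_serreLevel_eq 3 _ (mulSupport_serreLevel_baseChange_finite W 3 hρ j _) u (huq.symm ▸ hq3)
    rw [hN1, h0] at h1
    exact one_ne_zero h1
  have hMq : M.factorization q = 1 := by
    apply le_antisymm
    · exact hN1 ▸ (Nat.factorization_le_iff_dvd hM0 hN0).mpr hMN q
    · exact (hq.dvd_iff_one_le_factorization hM0).mp hqM
  exact ⟨M, hMz, hMN, h3M, hN1, hMq, g, ιg, hg, hgal⟩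

/-- **The door read on the crux's binders and the shadow predicate.** `E/ℚ` globally minimal, good at `3`, `Surj W 3` (crux 3's
large-image binder; ⟹ `Irr W 3`, `hasIrreducibleModPGaloisRep_of_hasSurjectiveModNGaloisRep`), and a prime `q ∉ {2, 3}` with
`(W ⊗ ℚ_[q]).kodairaSymbol ℤ_[q] ∈ {IV, IV*}` and `c_q = 3` (line `shadow_seed`'s `IsShadowPrimeAt W q`, branch `q ≡ 2 (mod 3)`, minus
its valuation clause): granted Modularity and Diamond 1995 BY NAME, a newform `g ∈ S₂(Γ₁(M))` with `ρ̄_g ≅ E[3] ⊗ 𝔽̄₃`, `M ∣ N(ρ̄')`,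
`3 ∤ M`, `q ∥ M`. (Additivity from the Kodaira symbol: `kodairaSymbolAt_eq_padic`, `isAdditive_kodairaSymbolAt_iff_holds`.)
[cite: Diamond1995RefinedSerre, Thm. 1.1] [cite: Serre1987, §1.2, §4.6] [cite: SilvermanATAEC1994, IV.9.4 (Tate's algorithm)] -/
theorem exists_newform_two_of_surj_of_kodairaSymbol_IV_or_IVstar (hmod : exists_isNewformOf)
    (hLL : diamond1995_refinedSerre)
    [TopologicalSpace (AlgebraicClosure (ZMod 3))] [DiscreteTopology (AlgebraicClosure (ZMod 3))]
    (W : WeierstrassCurve ℚ) [W.IsElliptic] (hgood : W.HasGoodReductionAtPrime 3) (hs : Surj W 3)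
    (q : ℕ) [Fact q.Prime] (hq2 : q ≠ 2) (hq3 : q ≠ 3)
    (hK : (W.baseChange ℚ_[q]).kodairaSymbol ℤ_[q] = KodairaSymbol.IV ∨
      (W.baseChange ℚ_[q]).kodairaSymbol ℤ_[q] = KodairaSymbol.IVstar)
    (hc : (W.baseChange ℚ_[q]).localTamagawaNumber ℤ_[q] = 3)
    {ρ : ModPGaloisRep ℚ (ZMod 3) 2} (hρ : W.IsTorsionGaloisRep 3 ρ) :
    ∃ (M : ℕ) (_ : NeZero M),
      M ∣ serreLevel 3 (FramedRep.baseChange (algebraMap (ZMod 3) (AlgebraicClosure (ZMod 3)))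
            continuous_of_discreteTopology ρ) ∧ ¬ 3 ∣ M ∧
      (serreLevel 3 (FramedRep.baseChange (algebraMap (ZMod 3) (AlgebraicClosure (ZMod 3)))
            continuous_of_discreteTopology ρ)).factorization q = 1 ∧
      M.factorization q = 1 ∧
      ∃ (g : CuspForm (Gamma1 M) 2) (ιg : coeffCharIntegers g →+* AlgebraicClosure (ZMod 3)),
        IsNewform1 g ∧ IsGaloisRepOfNewform1Int g ιg {r | r ∣ M * 3}
          (FramedRep.baseChange (algebraMap (ZMod 3) (AlgebraicClosure (ZMod 3)))
            continuous_of_discreteTopology ρ) := by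
  classical
  have hq : q.Prime := Fact.out
  haveI : NeZero ((3 : ℕ) : ℚ) := ⟨by norm_num⟩
  have hirr : Irr W 3 := hasIrreducibleModPGaloisRep_of_hasSurjectiveModNGaloisRep W 3 hs
  set v : HeightOneSpectrum (𝓞 ℚ) := (primesEquiv (R := 𝓞 ℚ)).symm ⟨q, hq⟩ with hvdef
  have hv : (primesEquiv v : Nat.Primes) = ⟨q, hq⟩ := Equiv.apply_symm_apply _ _
  have hKadd : ((W.baseChange ℚ_[q]).kodairaSymbol ℤ_[q]).IsAdditive := by
    rcases hK with h | h <;> rw [h] <;> decide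
  have hadd : W.HasAdditiveReductionAt v := by
    have key : ∀ r : Nat.Primes, primesEquiv v = r →
        (haveI := Fact.mk r.2; ((W.baseChange ℚ_[(r : ℕ)]).kodairaSymbol ℤ_[(r : ℕ)]).IsAdditive) →
        W.HasAdditiveReductionAt v := by
      rintro r rfl h
      haveI : PerfectField (IsLocalRing.ResidueField (v.adicCompletionIntegers ℚ)) := PerfectField.ofFinite
      refine (W.isAdditive_kodairaSymbolAt_iff_holds v).mp ?_
      rw [kodairaSymbolAt_eq_padic v W]
      exact h
    exact key ⟨q, hq⟩ hv hKadd
  have hng : ¬ W.HasGoodReductionAtPrime q := by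
    have key : ∀ r : Nat.Primes, primesEquiv v = r →
        (haveI := Fact.mk r.2; ¬ W.HasGoodReductionAtPrime (r : ℕ)) := by
      rintro r rfl h
      exact hadd.not_hasGoodReductionAt
        ((hasGoodReductionAtPrime_iff_hasGoodReductionAt_ringOfIntegers (v := v) W).mp h)
    exact key ⟨q, hq⟩ hv
  have hnm : ¬ W.HasMultiplicativeReductionAtPrime q := by
    have key : ∀ r : Nat.Primes, primesEquiv v = r →
        (haveI := Fact.mk r.2; ¬ W.HasMultiplicativeReductionAtPrime (r : ℕ)) := by
      rintro r rfl h
      exact hadd.not_hasMultiplicativeReductionAt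
        ((W.hasMultiplicativeReductionAtPrime_iff_hasMultiplicativeReductionAt_ringOfIntegers v).mp h)
    exact key ⟨q, hq⟩ hv
  exact exists_newform_two_of_dvd_localTamagawaNumber hmod hLL W hgood hirr q hq2 hq3 hng hnm (hc ▸ dvd_rfl) hρ

end Summit.BirchSwinnertonDyer.BirchSwinnertonDyer.Theorems.ShadowSeedLevelLowering

end
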